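import Mathlib
import HarnessLib
import Summits.HubbardSuperconductivity.HubbardSuperconductivity.Theses.ChiralWindow
import Summits.HubbardSuperconductivity.HubbardSuperconductivity.Theorems.ChiralWindowDefsBox
import Summits.HubbardSuperconductivity.HubbardSuperconductivity.Theorems.ChiralWindowDefsRecordL
import Summits.HubbardSuperconductivity.HubbardSuperconductivity.Theorems.ChiralWindowCwKLChiralWindowKlCertX
import Summits.HubbardSuperconductivity.HubbardSuperconductivity.Theorems.ChiralWindowCwChannelInfContinuousFilling
import Summits.HubbardSuperconductivity.HubbardSuperconductivity.Theorems.ChiralWindowCwKLChiralWindowStubKlFillingUpper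
import Summits.HubbardSuperconductivity.HubbardSuperconductivity.Theorems.ChiralWindowCwKLChiralWindowStubKlFillingLower

/-!
# Crux `CwKLChiralWindow` (stmt-1741), line `Sketch`: the crux from the box enclosures of the CONCRETE record `klCertL`

`cwKLChiralWindow_of_klCertL_boxes : klCertL.BoxEnclosures → CwKLChiralWindow` — the tree's endpoint of the certificate with NO
existential left: `klCertL` is the rational record literal of `Theorems/ChiralWindowDefsRecordL.lean` (PRIMARY record: wide
window `[-11053/10000, -441/400]`, four boxes, witness channel `E`, loosest checker-accepted tolerances), accepted by the `E_x`-form checker by kernel decision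
(`klCertL_checkX`), and `klCertL.BoxEnclosures` is the box part E1, E2, E3R, E4, E5S, E6 of the named numerical hypothesis
`KLCert.EnclosuresRS` for THAT literal — the certified interval-arithmetic computation (`ccert` seat; targets and tolerances in
`Cruxes/CwKLChiralWindow/CertTarget-c5.md`).  The filling part E0 of `EnclosuresRS` is discharged in Lean: `stub_klFillingUpper`
(p138359), `stub_klFillingLower` (p138691) on the bracket `[-111/100, -1] ∋ mub, mua`, transported by `monotone_filling`.
Then `cwKLChiralWindow_of_klCertX` (p134821) concludes.
-/

noncomputable section

set_option linter.dupNamespace false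

namespace Summit.HubbardSuperconductivity.HubbardSuperconductivity.Theorems

open MeasureTheory Literature.MathematicalPhysics.QuantumLattice CwKLChiralWindow
open Summit.HubbardSuperconductivity.HubbardSuperconductivity.Theses.ChiralWindow

/-- E0 for the record `klCertL`: its window ends lie in the bracket `[-111/100, -1]`, so the two filling inequalities follow from
`stub_klFillingLower`, `stub_klFillingUpper` and the monotonicity of the filling. [folklore] -/
theorem klCertL_fillings :
    KohnLuttinger.filling (squareDispersion 1 0) ((klCertL.mua : ℚ) : ℝ) ≤ 7 / 10 ∧
      (13 / 25 : ℝ) ≤ KohnLuttinger.filling (squareDispersion 1 0) ((klCertL.mub : ℚ) : ℝ) := by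
  have ha : ((klCertL.mua : ℚ) : ℝ) ≤ -1 := by norm_num [klCertL]
  have hb : (-111 / 100 : ℝ) ≤ ((klCertL.mub : ℚ) : ℝ) := by norm_num [klCertL]
  exact ⟨(monotone_filling ha).trans stub_klFillingUpper, stub_klFillingLower.trans (monotone_filling hb)⟩

/-- **The crux from the certified box enclosures of the record `klCertL`.** [folklore] -/
theorem cwKLChiralWindow_of_klCertL_boxes : klCertL.BoxEnclosures → CwKLChiralWindow := fun hbox =>
  cwKLChiralWindow_of_klCertX klCertL klCertL_checkX ⟨klCertL_fillings.1, klCertL_fillings.2, hbox⟩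

end Summit.HubbardSuperconductivity.HubbardSuperconductivity.Theorems

end
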